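import Literature.NumberTheory.Transcendental.KaehlerHodgeStarTypeProofs
import Literature.NumberTheory.Transcendental.ComplexFormsSmoothProofs
import Literature.NumberTheory.Transcendental.KaehlerHodgeTypeComponentFact

/-!
# `Δ_∂̄` is bihomogeneous; harmonic forms have harmonic `(p,q)`-components given `Δ_d = 2Δ_∂̄`

Theorems-only companion file of `Literature/NumberTheory/Transcendental/KaehlerHodge.lean` (C12),
second half (after `KaehlerHodgeStarTypeProofs.lean`) of the reduction of the named fact
`Literature.NumberTheory.Transcendental.typeComponent_mem_charmonicForms` — Voisin (2002), §6.1.2,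
**Corollary 6.9**: *if `α ∈ A^k(X)` is harmonic (for `Δ_d`, `X` Kähler), its components `α^{p,q}`
are harmonic* — to the Kähler identity `Δ_d = 2Δ_∂̄` (Voisin (2002), Thm. 6.7), which is the
separate named fact
`Literature.NumberTheory.Transcendental.cHodgeLaplacian_eq_two_smul_dolbeaultLaplacian_of_isManifold_complex`
of the same file (corrected form of `cHodgeLaplacian_eq_two_smul_dolbeaultLaplacian`; not proved here). Voisin's proof: by Thm. 6.7, `Δ_d = 2Δ_∂` with `Δ_∂` "clearly
bihomogeneous" (Cor. 6.8), and the type decomposition is direct. Contents: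

* `dolbeaultBar_typeComponent`, `dolbeault_typeComponent`: **`∂̄ ∘ Π^{p,q} = Π^{p,q+1} ∘ ∂̄`** and
  **`∂ ∘ Π^{p,q} = Π^{p+1,q} ∘ ∂`**, unconditionally (no smoothness), straight from the definitions
  `∂̄α = ∑_{p+q=k} (dα^{p,q})^{p,q+1}`, `∂α = ∑ (dα^{p,q})^{p+1,q}` of `Dolbeault.lean` and the
  idempotence/orthogonality of the projections (`typeComponent_typeComponent`); also
  `(∂̄α)^{p,0} = 0`, `(∂α)^{0,q} = 0`. Voisin (2002), §2.3.3 (Def. of `∂̄`), Huybrechts (2005),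
  Lemma 1.3.6;
* `dolbeaultBarAdjoint_typeComponent`: **`∂̄* = -⋆∂⋆` lowers the type by `(0,1)`**,
  `∂̄* ∘ Π^{p,q+1} = Π^{p,q} ∘ ∂̄*` and `∂̄* ∘ Π^{p,0} = 0`, for a Hermitian metric
  (Huybrechts (2005), Def. 3.1.3; Voisin (2002), §5.1.3), from
  `⋆ ∘ Π^{p,q} = Π^{d-q,d-p} ∘ ⋆` (`cHodgeStar_typeComponent`) and the vanishing of types beyond the
  dimension (`typeComponent_eq_zero_of_finrank_lt_or_lt`);
* `dolbeaultLaplacian_typeComponent`: **`Δ_∂̄` is bihomogeneous**, `Δ_∂̄ ∘ Π^{p,q} = Π^{p,q} ∘ Δ_∂̄`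
  on all complex forms of a manifold with a Hermitian metric (Huybrechts (2005), Prop. 3.2.6 (i);
  Voisin (2002), proof of Cor. 6.8), unconditionally in the form;
* `typeComponent_mem_charmonicForms_of_kaehlerIdentity`: **Cor. 6.9 from Thm. 6.7** — on a
  complex manifold (`[IsManifold 𝓘(ℂ, E) ω M]`), given the Kähler identity fact `Δ_d = 2Δ_∂̄` in its
  corrected form `cHodgeLaplacian_eq_two_smul_dolbeaultLaplacian_of_isManifold_complex g o` (on smooth
  forms, in the degree at hand; `KaehlerHodge.lean`, *Correction*), `Δ_d`-harmonic complex forms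
  have `Δ_d`-harmonic `(p,q)`-components: for a harmonic generator `β`, `Δ_∂̄ β = 0`, so
  `Δ_∂̄ β^{p,q} = (Δ_∂̄ β)^{p,q} = 0` and `Δ_d β^{p,q} = 2Δ_∂̄ β^{p,q} = 0` (`β^{p,q}` is smooth on a
  complex manifold, `IsSmoothForm.typeComponent`); the span `charmonicForms` is then handled by
  linearity of `Π^{p,q}`.

**On the statement of `typeComponent_mem_charmonicForms`.** Like every named fact of the sections
`Hermitian`/`Kaehler` of `KaehlerHodge.lean` (see its module docstring, *Correction*), the `def`
`typeComponent_mem_charmonicForms g o` does not abstract the section's complex-manifold instance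
`[IsManifold 𝓘(ℂ, E) ω M]` (its body never uses it: `#check @typeComponent_mem_charmonicForms` lists
`[IsManifold 𝓘(ℝ, E) ∞ M]` as the only atlas hypothesis), so as a `Prop` family it also speaks about
real `C^∞` manifolds charted on `E` without a holomorphic atlas, where `typeComponent` is not
tensorial and type components of smooth forms need not be smooth — not Voisin's Cor. 6.9, which is
about Kähler, in particular complex, manifolds. The theorem below proves the `Prop` exactly where it
is meant, **at a complex manifold** (the instance is a hypothesis of the theorem), from the corrected
Kähler identity; the corrected *named* form of Cor. 6.9 (the same body with the complex-manifold
binders on the `def`) is filed on `KaehlerHodge.lean` separately and is definitionally this `Prop`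
there.

The Hermitian hypothesis is used in the instance form
`hH : ∀ x v w, ⟪J v, J w⟫ = ⟪v, w⟫` for the ambient `[RiemannianBundle]`; for the metric term `g`
of the C12 statements, installed by `letI : RiemannianBundle _ := ⟨g.toRiemannianMetric⟩`, this is
definitionally `g.toRiemannianMetric.IsHermitian` (supplied by `IsKaehler.isHermitian`).

## References

* C. Voisin, *Hodge Theory and Complex Algebraic Geometry I*, Cambridge Studies in Advanced
  Mathematics 76 (2002), §2.3.3; §5.1.3, Lemma 5.8; §6.1.2, Thm. 6.7, Cor. 6.8, Cor. 6.9.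
* D. Huybrechts, *Complex Geometry. An Introduction*, Universitext (2005), Lemma 1.2.24,
  Exercise 1.2.3, Lemma 1.3.6, Def. 3.1.3 (`∂̄* : A^{p,q} → A^{p,q-1}`), Lemma 3.2.3, Prop. 3.2.6.
-/

noncomputable section

open scoped Manifold ContDiff Topology ComplexConjugate RealInnerProductSpace
open Bundle Module Set Finset

namespace Literature.NumberTheory.Transcendental

/-! ### `∂̄`, `∂` and the type projections (unconditional) -/

section DolbeaultOps

variable {E : Type*} [NormedAddCommGroup E] [NormedSpace ℂ E]
  {M : Type*} [TopologicalSpace M] [ChartedSpace E M] {k : ℕ}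

/-- **`∂̄` raises the type by `(0,1)`, projector form: `∂̄(β^{p,q}) = (∂̄β)^{p,q+1}`** for every
complex `k`-form `β` and all `p, q` (both sides are `0` when `p + q ≠ k`). Unconditional: with
`∂̄β = ∑_{a+b=k} (dβ^{a,b})^{a,b+1}` only the summand `(a,b) = (p,q)` survives on either side
(`typeComponent_typeComponent`). Voisin (2002), §2.3.3; Huybrechts (2005), Lemma 1.3.6.
[cite: Voisin2002, §2.3.3] -/
theorem dolbeaultBar_typeComponent (p q : ℕ) (β : Literature.Geometry.Kaehler.MForm 𝓘(ℝ, E) M ℂ k) :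
    dolbeaultBar (β.typeComponent p q) = (dolbeaultBar β).typeComponent p (q + 1) := by
  by_cases hpq : p + q = k
  · have hmem : (p, q) ∈ antidiagonal k := mem_antidiagonal.mpr hpq
    have hL : ∑ ab ∈ antidiagonal k, (Literature.Geometry.Kaehler.mextDeriv
        ((β.typeComponent p q).typeComponent ab.1 ab.2)).typeComponent ab.1 (ab.2 + 1) =
        (Literature.Geometry.Kaehler.mextDeriv (β.typeComponent p q)).typeComponent p (q + 1) := by
      rw [Finset.sum_eq_single (p, q)]
      · rw [typeComponent_typeComponent_self_holds]
      · rintro ⟨a, b⟩ _ hne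
        have hne' : ¬(p = a ∧ q = b) := fun hh ↦ hne (by rw [hh.1, hh.2])
        rw [typeComponent_typeComponent_holds, if_neg hne', Literature.Geometry.Kaehler.mextDeriv_zero,
          Literature.Geometry.Kaehler.MForm.typeComponent_zero]
      · exact fun hh ↦ absurd hmem hh
    have hR : ∑ ab ∈ antidiagonal k, ((Literature.Geometry.Kaehler.mextDeriv
        (β.typeComponent ab.1 ab.2)).typeComponent ab.1 (ab.2 + 1)).typeComponent p (q + 1) =
        (Literature.Geometry.Kaehler.mextDeriv (β.typeComponent p q)).typeComponent p (q + 1) := by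
      rw [Finset.sum_eq_single (p, q)]
      · rw [typeComponent_typeComponent_self_holds]
      · rintro ⟨a, b⟩ _ hne
        have hne' : ¬(a = p ∧ b + 1 = q + 1) := fun hh ↦ hne (by rw [hh.1]; congr 1; omega)
        rw [typeComponent_typeComponent_holds, if_neg hne']
      · exact fun hh ↦ absurd hmem hh
    rw [dolbeaultBar, dolbeaultBar, Literature.Geometry.Kaehler.MForm.typeComponent_sum, hL, hR]
  · rw [Literature.Geometry.Kaehler.MForm.typeComponent_of_ne hpq, dolbeaultBar_zero,
      Literature.Geometry.Kaehler.MForm.typeComponent_of_ne (show p + (q + 1) ≠ k + 1 by omega)]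

/-- **`∂` raises the type by `(1,0)`, projector form: `∂(β^{p,q}) = (∂β)^{p+1,q}`** for every
complex `k`-form `β` and all `p, q`, unconditionally (as for `dolbeaultBar_typeComponent`).
Voisin (2002), §2.3.3; Huybrechts (2005), Lemma 1.3.6. [cite: Voisin2002, §2.3.3] -/
theorem dolbeault_typeComponent (p q : ℕ) (β : Literature.Geometry.Kaehler.MForm 𝓘(ℝ, E) M ℂ k) :
    dolbeault (β.typeComponent p q) = (dolbeault β).typeComponent (p + 1) q := by
  by_cases hpq : p + q = k
  · have hmem : (p, q) ∈ antidiagonal k := mem_antidiagonal.mpr hpq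
    have hL : ∑ ab ∈ antidiagonal k, (Literature.Geometry.Kaehler.mextDeriv
        ((β.typeComponent p q).typeComponent ab.1 ab.2)).typeComponent (ab.1 + 1) ab.2 =
        (Literature.Geometry.Kaehler.mextDeriv (β.typeComponent p q)).typeComponent (p + 1) q := by
      rw [Finset.sum_eq_single (p, q)]
      · rw [typeComponent_typeComponent_self_holds]
      · rintro ⟨a, b⟩ _ hne
        have hne' : ¬(p = a ∧ q = b) := fun hh ↦ hne (by rw [hh.1, hh.2])
        rw [typeComponent_typeComponent_holds, if_neg hne', Literature.Geometry.Kaehler.mextDeriv_zero,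
          Literature.Geometry.Kaehler.MForm.typeComponent_zero]
      · exact fun hh ↦ absurd hmem hh
    have hR : ∑ ab ∈ antidiagonal k, ((Literature.Geometry.Kaehler.mextDeriv
        (β.typeComponent ab.1 ab.2)).typeComponent (ab.1 + 1) ab.2).typeComponent (p + 1) q =
        (Literature.Geometry.Kaehler.mextDeriv (β.typeComponent p q)).typeComponent (p + 1) q := by
      rw [Finset.sum_eq_single (p, q)]
      · rw [typeComponent_typeComponent_self_holds]
      · rintro ⟨a, b⟩ _ hne
        have hne' : ¬(a + 1 = p + 1 ∧ b = q) := fun hh ↦ hne (by rw [hh.2]; congr 1; omega)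
        rw [typeComponent_typeComponent_holds, if_neg hne']
      · exact fun hh ↦ absurd hmem hh
    rw [dolbeault, dolbeault, Literature.Geometry.Kaehler.MForm.typeComponent_sum, hL, hR]
  · rw [Literature.Geometry.Kaehler.MForm.typeComponent_of_ne hpq, dolbeault_zero,
      Literature.Geometry.Kaehler.MForm.typeComponent_of_ne (show (p + 1) + q ≠ k + 1 by omega)]

/-- **`∂̄β` has no component of type `(p,0)`**: `(∂̄β)^{p,0} = 0` (every summand of `∂̄β` is a
`(a,b+1)`-component). Voisin (2002), §2.3.3. [cite: Voisin2002, §2.3.3] -/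
theorem typeComponent_dolbeaultBar_zero_right (p : ℕ)
    (β : Literature.Geometry.Kaehler.MForm 𝓘(ℝ, E) M ℂ k) :
    (dolbeaultBar β).typeComponent p 0 = 0 := by
  rw [dolbeaultBar, Literature.Geometry.Kaehler.MForm.typeComponent_sum]
  refine Finset.sum_eq_zero fun ab _ ↦ ?_
  rw [typeComponent_typeComponent_holds, if_neg]
  omega

/-- **`∂β` has no component of type `(0,q)`**: `(∂β)^{0,q} = 0` (every summand of `∂β` is an
`(a+1,b)`-component). Voisin (2002), §2.3.3. [cite: Voisin2002, §2.3.3] -/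
theorem typeComponent_dolbeault_zero_left (q : ℕ)
    (β : Literature.Geometry.Kaehler.MForm 𝓘(ℝ, E) M ℂ k) :
    (dolbeault β).typeComponent 0 q = 0 := by
  rw [dolbeault, Literature.Geometry.Kaehler.MForm.typeComponent_sum]
  refine Finset.sum_eq_zero fun ab _ ↦ ?_
  rw [typeComponent_typeComponent_holds, if_neg]
  omega

/-- Every complex `0`-form (function) has type `(0,0)` (there are no vector arguments to rotate).
Voisin (2002), §2.3.1. [folklore] -/
theorem isOfType_zero_zero (β : Literature.Geometry.Kaehler.MForm 𝓘(ℝ, E) M ℂ 0) : IsOfType 0 0 β :=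
  ⟨rfl, fun x θ v ↦ by
    have hv : (fun i ↦ tangentRotate E x θ (v i)) = v := funext fun i ↦ Fin.elim0 i
    rw [hv]
    simp⟩

end DolbeaultOps

/-! ### `∂̄*` and `Δ_∂̄` preserve types (Hermitian metric) -/

section Adjoint

variable {E : Type*} [NormedAddCommGroup E] [NormedSpace ℂ E]
  {M : Type*} [TopologicalSpace M] [ChartedSpace E M] {k m : ℕ}
  [FiniteDimensional ℂ E] {n : ℕ} [Fact (finrank ℝ E = n)]
  [RiemannianBundle (fun x : M ↦ TangentSpace 𝓘(ℝ, E) x)]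
  (o : (x : M) → Orientation ℝ (TangentSpace 𝓘(ℝ, E) x) (Fin n))

/-- `∂̄* 0 = 0` (`⋆` is linear and `∂ 0 = 0`). [folklore] -/
@[simp]
theorem dolbeaultBarAdjoint_zero (h : (k + 1) + m = n) :
    dolbeaultBarAdjoint o h (0 : Literature.Geometry.Kaehler.MForm 𝓘(ℝ, E) M ℂ (k + 1)) = 0 := by
  simp [dolbeaultBarAdjoint]

/-- **`∂̄* = -⋆∂⋆` lowers the type by `(0,1)`**, projector form, for a Hermitian metric:
`∂̄*(γ^{p,q+1}) = (∂̄*γ)^{p,q}` for every complex `(k+1)`-form `γ` and all `p, q` —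
Huybrechts (2005), Def. 3.1.3: "`∂̄* := -*∘∂∘*` … Due to Lemma 1.2.24 the Hodge `*`-operator maps
`A^{p,q}(X)` to `A^{n-q,n-p}(X)`. Thus `∂̄* : A^{p,q}(X) → A^{p,q-1}(X)`"; Voisin (2002), §5.1.3
(Lemma 5.8 and the display before Lemma 5.10). Unconditional in `γ`. Proof: for `p ≤ d`,
`q + 1 ≤ d` chase the types through `⋆`, `∂`, `⋆` (`cHodgeStar_typeComponent`,
`dolbeault_typeComponent`); otherwise both sides vanish (`typeComponent_eq_zero_of_finrank_lt_or_lt`,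
and in the boundary case `q = d` also `(∂⋆γ)^{0,·} = 0`). [cite: Huybrechts2005, Def. 3.1.3] -/
theorem dolbeaultBarAdjoint_typeComponent
    (hH : ∀ (x : M) (v w : TangentSpace 𝓘(ℝ, E) x),
      ⟪Literature.Geometry.Kaehler.tangentJ E x v, Literature.Geometry.Kaehler.tangentJ E x w⟫ = ⟪v, w⟫)
    (h : (k + 1) + m = n) (p q : ℕ) (γ : Literature.Geometry.Kaehler.MForm 𝓘(ℝ, E) M ℂ (k + 1)) :
    dolbeaultBarAdjoint o h (γ.typeComponent p (q + 1)) =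
      (dolbeaultBarAdjoint o h γ).typeComponent p q := by
  have hn : n = 2 * finrank ℂ E := by
    rw [← (Fact.out : finrank ℝ E = n), finrank_real_of_complex]
  set d := finrank ℂ E with hd
  by_cases hpq : p + q = k
  swap
  · rw [Literature.Geometry.Kaehler.MForm.typeComponent_of_ne (show p + (q + 1) ≠ k + 1 by omega),
      dolbeaultBarAdjoint_zero, Literature.Geometry.Kaehler.MForm.typeComponent_of_ne hpq]
  by_cases hgood : p ≤ d ∧ q + 1 ≤ d
  · obtain ⟨p', hp'⟩ := Nat.exists_eq_add_of_le hgood.2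
    obtain ⟨q', hq'⟩ := Nat.exists_eq_add_of_le hgood.1
    unfold dolbeaultBarAdjoint
    rw [Literature.Geometry.Kaehler.MForm.typeComponent_neg,
      cHodgeStar_typeComponent o hH h (show p + (q + 1) = k + 1 by omega) (show p' + q' = m by omega)
        (by push_cast; omega) γ,
      dolbeault_typeComponent,
      cHodgeStar_typeComponent o hH (show (m + 1) + k = n by omega)
        (show (p' + 1) + q' = m + 1 by omega) hpq (by push_cast; omega)]
  · have hbad : d < p ∨ d < q + 1 := by omega
    rw [typeComponent_eq_zero_of_finrank_lt_or_lt o hH h hbad, dolbeaultBarAdjoint_zero]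
    by_cases hbad' : d < p ∨ d < q
    · rw [typeComponent_eq_zero_of_finrank_lt_or_lt o hH (show k + (m + 1) = n by omega) hbad']
    · unfold dolbeaultBarAdjoint
      rw [Literature.Geometry.Kaehler.MForm.typeComponent_neg,
        ← cHodgeStar_typeComponent o hH (show (m + 1) + k = n by omega)
          (show 0 + (m + 1) = m + 1 by omega) hpq (by push_cast; omega),
        typeComponent_dolbeault_zero_left, map_zero, neg_zero]

/-- **`∂̄*` kills `(p,0)`-components**: `∂̄*(γ^{p,0}) = 0` for a Hermitian metric (there is no type
`(p,-1)`: `∂̄* : A^{p,q} → A^{p,q-1}`, Huybrechts (2005), Def. 3.1.3; Voisin (2002), §5.1.3).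
Proof: `⋆γ^{k+1,0}` has type `(d, d-k-1)` and `∂` of it type `(d+1, ·)`, which vanishes; or
`γ^{k+1,0} = 0` if `k + 1 > d`. [cite: Huybrechts2005, Def. 3.1.3] -/
theorem dolbeaultBarAdjoint_typeComponent_zero
    (hH : ∀ (x : M) (v w : TangentSpace 𝓘(ℝ, E) x),
      ⟪Literature.Geometry.Kaehler.tangentJ E x v, Literature.Geometry.Kaehler.tangentJ E x w⟫ = ⟪v, w⟫)
    (h : (k + 1) + m = n) (p : ℕ) (γ : Literature.Geometry.Kaehler.MForm 𝓘(ℝ, E) M ℂ (k + 1)) :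
    dolbeaultBarAdjoint o h (γ.typeComponent p 0) = 0 := by
  have hn : n = 2 * finrank ℂ E := by
    rw [← (Fact.out : finrank ℝ E = n), finrank_real_of_complex]
  set d := finrank ℂ E with hd
  by_cases hp : p + 0 = k + 1
  swap
  · rw [Literature.Geometry.Kaehler.MForm.typeComponent_of_ne hp, dolbeaultBarAdjoint_zero]
  by_cases hkd : k + 1 ≤ d
  · obtain ⟨q', hq'⟩ := Nat.exists_eq_add_of_le (show d ≤ m by omega)
    unfold dolbeaultBarAdjoint
    rw [cHodgeStar_typeComponent o hH h hp (show d + q' = m by omega) (by push_cast; omega) γ,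
      dolbeault_typeComponent,
      typeComponent_eq_zero_of_finrank_lt_or_lt o hH (show (m + 1) + k = n by omega)
        (Or.inl (Nat.lt_succ_self d)),
      map_zero, neg_zero]
  · rw [typeComponent_eq_zero_of_finrank_lt_or_lt o hH h (Or.inl (by omega)), dolbeaultBarAdjoint_zero]

/-- **`Δ_∂̄` is bihomogeneous (bidegree `(0,0)`)** on a complex manifold with a Hermitian metric:
`Δ_∂̄(α^{p,q}) = (Δ_∂̄ α)^{p,q}` for every complex `k`-form `α` (`k + m = 2d`) and all `p, q` —
Huybrechts (2005), Prop. 3.2.6 (i) (`Δ_∂̄(α^{p,q}) ∈ A^{p,q}`, not necessarily compact `X`);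
Voisin (2002), §6.1.2, proof of Cor. 6.8 ("`Δ_∂` is clearly bihomogeneous"). From
`Δ_∂̄ = ∂̄∂̄* + ∂̄*∂̄` (the four degree cases of `dolbeaultLaplacian`) with
`dolbeaultBar_typeComponent` and `dolbeaultBarAdjoint_typeComponent`; no smoothness is needed.
[cite: Huybrechts2005, Prop. 3.2.6 (i)] -/
theorem dolbeaultLaplacian_typeComponent
    (hH : ∀ (x : M) (v w : TangentSpace 𝓘(ℝ, E) x),
      ⟪Literature.Geometry.Kaehler.tangentJ E x v, Literature.Geometry.Kaehler.tangentJ E x w⟫ = ⟪v, w⟫)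
    (h : k + m = n) (p q : ℕ) (α : Literature.Geometry.Kaehler.MForm 𝓘(ℝ, E) M ℂ k) :
    dolbeaultLaplacian o k m h (α.typeComponent p q) =
      (dolbeaultLaplacian o k m h α).typeComponent p q := by
  rcases k with - | k <;> rcases m with - | m
  · simp [dolbeaultLaplacian]
  · simp only [dolbeaultLaplacian]
    by_cases hpq : p + q = 0
    · obtain ⟨rfl, rfl⟩ : p = 0 ∧ q = 0 := by omega
      rw [(isOfType_zero_zero α).typeComponent_eq_self, (isOfType_zero_zero _).typeComponent_eq_self]
    · rw [Literature.Geometry.Kaehler.MForm.typeComponent_of_ne hpq,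
        Literature.Geometry.Kaehler.MForm.typeComponent_of_ne hpq, dolbeaultBar_zero,
        dolbeaultBarAdjoint_zero]
  · simp only [dolbeaultLaplacian]
    rcases q with - | q
    · rw [dolbeaultBarAdjoint_typeComponent_zero o hH, dolbeaultBar_zero,
        typeComponent_dolbeaultBar_zero_right]
    · rw [dolbeaultBarAdjoint_typeComponent o hH, dolbeaultBar_typeComponent]
  · simp only [dolbeaultLaplacian]
    rw [Literature.Geometry.Kaehler.MForm.typeComponent_add]
    rcases q with - | q
    · rw [dolbeaultBarAdjoint_typeComponent_zero o hH, dolbeaultBar_zero, zero_add,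
        dolbeaultBar_typeComponent, dolbeaultBarAdjoint_typeComponent o hH,
        typeComponent_dolbeaultBar_zero_right, zero_add]
    · rw [dolbeaultBarAdjoint_typeComponent o hH, dolbeaultBar_typeComponent,
        dolbeaultBar_typeComponent, dolbeaultBarAdjoint_typeComponent o hH]

end Adjoint

/-! ### Corollary 6.9 from Theorem 6.7 -/

section Kaehler

variable {E : Type*} [NormedAddCommGroup E] [NormedSpace ℂ E]
  {M : Type*} [TopologicalSpace M] [ChartedSpace E M] {k m : ℕ}
  [FiniteDimensional ℂ E] {n : ℕ} [Fact (finrank ℝ E = n)]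
  [IsManifold 𝓘(ℂ, E) ω M] [IsManifold 𝓘(ℝ, E) ∞ M]
  (g : ContMDiffRiemannianMetric 𝓘(ℝ, E) ∞ E (fun x : M ↦ TangentSpace 𝓘(ℝ, E) x))
  (o : (x : M) → Orientation ℝ (TangentSpace 𝓘(ℝ, E) x) (Fin n))

/-- **Harmonic forms on a Kähler manifold have harmonic `(p,q)`-components, given the Kähler
identity `Δ_d = 2Δ_∂̄`** (Voisin (2002), §6.1.2, Cor. 6.9 deduced from Thm. 6.7): on a complex
manifold `M` (holomorphic atlas — a hypothesis of this theorem, see the module docstring) the `Prop`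
`typeComponent_mem_charmonicForms g o` (degree `k`, `k + m = 2d`) follows from the corrected Kähler
identity fact `cHodgeLaplacian_eq_two_smul_dolbeaultLaplacian_of_isManifold_complex g o` in the same
degree. For a `Δ_d`-harmonic smooth `β`: `2Δ_∂̄ β = Δ_d β = 0`, so `Δ_∂̄ β^{p,q} = (Δ_∂̄ β)^{p,q} = 0`
(`dolbeaultLaplacian_typeComponent`, the metric being Hermitian by `IsKaehler.isHermitian`) and
`Δ_d β^{p,q} = 2Δ_∂̄ β^{p,q} = 0`, `β^{p,q}` being smooth (`IsSmoothForm.typeComponent`, holomorphic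
atlas); the `ℂ`-span `charmonicForms` follows by linearity of `Π^{p,q}`. Huybrechts (2005),
Prop. 3.2.6 (ii). [cite: Voisin2002, §6.1.2 Cor. 6.9] -/
theorem typeComponent_mem_charmonicForms_of_kaehlerIdentity
    (hK : cHodgeLaplacian_eq_two_smul_dolbeaultLaplacian_of_isManifold_complex (k := k) (m := m) g o) :
    typeComponent_mem_charmonicForms (k := k) (m := m) g o := by
  intro hg h p q α ho hα
  letI : RiemannianBundle (fun x : M ↦ TangentSpace 𝓘(ℝ, E) x) := ⟨g.toRiemannianMetric⟩
  have hH : ∀ (x : M) (v w : TangentSpace 𝓘(ℝ, E) x),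
      ⟪Literature.Geometry.Kaehler.tangentJ E x v, Literature.Geometry.Kaehler.tangentJ E x w⟫ = ⟪v, w⟫ :=
    fun x v w ↦ hg.isHermitian x v w
  refine Submodule.span_induction ?_ ?_ ?_ ?_ hα
  · intro β hβ
    refine Submodule.subset_span ⟨hβ.1.typeComponent p q, ?_⟩
    have hΔ : dolbeaultLaplacian o k m h β = 0 := by
      have h2 := hK hg h hβ.1 ho
      rw [hβ.2] at h2
      exact (smul_eq_zero_iff_right two_ne_zero).mp h2.symm
    rw [hK hg h (hβ.1.typeComponent p q) ho, dolbeaultLaplacian_typeComponent o hH h p q β, hΔ,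
      Literature.Geometry.Kaehler.MForm.typeComponent_zero, smul_zero]
  · rw [Literature.Geometry.Kaehler.MForm.typeComponent_zero]
    exact zero_mem _
  · intro β γ _ _ hβ hγ
    rw [Literature.Geometry.Kaehler.MForm.typeComponent_add]
    exact add_mem hβ hγ
  · intro c β _ hβ
    rw [Literature.Geometry.Kaehler.MForm.typeComponent_smul]
    exact Submodule.smul_mem _ c hβ

end Kaehler

/-! ### Appended (v2): the corrected named fact from the corrected Kähler identity

`KaehlerHodgeTypeComponentFact.lean` records the corrected statement of Cor. 6.9,
`typeComponent_mem_charmonicForms_of_isManifold_complex g o` (holomorphic atlas as a binder of the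
`def`; at a complex manifold definitionally the old `Prop`,
`typeComponent_mem_charmonicForms_of_isManifold_complex_iff`). The theorem below is the glue
**Cor. 6.9 ⇐ Thm. 6.7** between the two corrected named facts: once
`cHodgeLaplacian_eq_two_smul_dolbeaultLaplacian_of_isManifold_complex_holds` exists,
`typeComponent_mem_charmonicForms_of_isManifold_complex_holds` is this theorem applied to it (and
the real form follows by `typeComponent_mem_harmonicForms_of_isManifold_complex_of`). -/

section KaehlerCorrected

variable {E : Type*} [NormedAddCommGroup E] [NormedSpace ℂ E]
  {M : Type*} [TopologicalSpace M] [ChartedSpace E M] {k m : ℕ}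
  [FiniteDimensional ℂ E] {n : ℕ} [Fact (finrank ℝ E = n)]
  [IsManifold 𝓘(ℂ, E) ω M] [IsManifold 𝓘(ℝ, E) ∞ M]
  (g : ContMDiffRiemannianMetric 𝓘(ℝ, E) ∞ E (fun x : M ↦ TangentSpace 𝓘(ℝ, E) x))
  (o : (x : M) → Orientation ℝ (TangentSpace 𝓘(ℝ, E) x) (Fin n))

/-- **Cor. 6.9 from Thm. 6.7, corrected named facts** (Voisin (2002), §6.1.2): on a complex
manifold, the corrected type-preservation fact
`typeComponent_mem_charmonicForms_of_isManifold_complex g o` (degree `k`, `k + m = n`) follows from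
the corrected Kähler identity `cHodgeLaplacian_eq_two_smul_dolbeaultLaplacian_of_isManifold_complex g o`
in the same degree — `typeComponent_mem_charmonicForms_of_kaehlerIdentity` read through the
definitional `typeComponent_mem_charmonicForms_of_isManifold_complex_iff`.
[cite: Voisin2002, §6.1.2 Cor. 6.9] -/
theorem typeComponent_mem_charmonicForms_of_isManifold_complex_of_kaehlerIdentity
    (hK : cHodgeLaplacian_eq_two_smul_dolbeaultLaplacian_of_isManifold_complex (k := k) (m := m) g o) :
    typeComponent_mem_charmonicForms_of_isManifold_complex (k := k) (m := m) g o :=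
  (typeComponent_mem_charmonicForms_of_isManifold_complex_iff g o).2
    (typeComponent_mem_charmonicForms_of_kaehlerIdentity g o hK)

end KaehlerCorrected

end Literature.NumberTheory.Transcendental
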